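import Mathlib
import Summits.AtomisticToContinuum.Crystallization.Theses.ReggeStarCoercivity
import Literature.MathematicalPhysics.StatisticalMechanics.LennardJonesThermodynamicLimitProofs

/-!
# `CoercivityForcesZeroDefects`
(route `ReggeStarCoercivity`, item `stmt-AtomisticToContinuum-13605`)

Elementary real-analysis glue: `StarCoercivity → CrysEnergyUpper → ZeroDefectDensity`.

PROOF. Fix a sequence of Lennard-Jones ground states `x N` (`IsGroundState`: `x N` is injective
and `𝓔(x N) = E(N)`). Star coercivity at `x N` reads `N·e_per + g·#def(N) − C·N^(2/3) ≤ E(N)`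
with `e_per = ⨅_Q e(Q)` over periodic configurations and `g > 0`. The thermodynamic limit
`E(N)/N → e_∞` (`BlancLewin2015_8_holds`, proved in the tree) and the trial-state upper bound
`limsup E(N)/N ≤ e_per` (`CrysEnergyUpper`) give `e_∞ ≤ e_per`. Hence, for `N ≥ 1`,
`0 ≤ #def(N)/N ≤ b N := ((E(N)/N − e_per) + C·N^(2/3)/N)/g`, and
`b N → (e_∞ − e_per)/g ≤ 0`;
squeezing between `0` and `max (b N) 0 → 0` gives `#def(N)/N → 0`, i.e. `ZeroDefectDensity`.
The real-analysis core is isolated in `coercivityForcesZeroDefects_squeeze`, stated for abstract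
sequences `E a : ℕ → ℝ`, so that the defect count enters only by unification.
-/

noncomputable section

namespace Summit.AtomisticToContinuum.Crystallization.Theorems

open Summit.AtomisticToContinuum.Crystallization.Theses.ReggeStarCoercivity
open Literature.MathematicalPhysics.StatisticalMechanics
open Filter Topology

/-- Real-analysis core of `CoercivityForcesZeroDefects`: if `0 ≤ a N`,
`N·e_per + g·a N − C·N^(2/3) ≤ E N` for all `N` with `g > 0`, and `E N / N → e ≤ e_per`,
then `a N / N → 0`. (For `N ≥ 1`,
`a N / N ≤ ((E N/N − e_per) + C·N^(2/3)/N)/g → (e − e_per)/g ≤ 0`; squeeze with `max · 0`.) -/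
theorem coercivityForcesZeroDefects_squeeze {E a : ℕ → ℝ} {e eper g C : ℝ} (hg : 0 < g)
    (ha0 : ∀ N, 0 ≤ a N)
    (hbound : ∀ N : ℕ, (N : ℝ) * eper + g * a N - C * (N : ℝ) ^ (2 / 3 : ℝ) ≤ E N)
    (hE : Tendsto (fun N : ℕ => E N / N) atTop (𝓝 e)) (he : e ≤ eper) :
    Tendsto (fun N : ℕ => a N / N) atTop (𝓝 0) := by
  -- the power correction `N^(2/3)/N = N^(-1/3) → 0`
  have hpow : Tendsto (fun N : ℕ => (N : ℝ) ^ (2 / 3 : ℝ) / N) atTop (𝓝 0) := by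
    have h1 : Tendsto (fun y : ℝ => y ^ (-(1 / 3 : ℝ))) atTop (𝓝 0) :=
      tendsto_rpow_neg_atTop (by norm_num)
    refine (h1.comp tendsto_natCast_atTop_atTop).congr' ?_
    filter_upwards [eventually_gt_atTop 0] with N hN
    have hN : (0 : ℝ) < N := by exact_mod_cast hN
    simp only [Function.comp_apply]
    rw [show (-(1 / 3 : ℝ)) = 2 / 3 - 1 by norm_num, Real.rpow_sub hN, Real.rpow_one]
  -- the comparison sequence and its limit
  have hbt : Tendsto (fun N : ℕ => ((E N / N - eper) + C * ((N : ℝ) ^ (2 / 3 : ℝ) / N)) / g)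
      atTop (𝓝 (((e - eper) + C * 0) / g)) :=
    ((hE.sub_const eper).add (hpow.const_mul C)).div_const g
  have hL : ((e - eper) + C * 0) / g ≤ 0 := by
    rw [mul_zero, add_zero]
    exact div_nonpos_of_nonpos_of_nonneg (sub_nonpos.2 he) hg.le
  have hmax : Tendsto (fun N : ℕ =>
      max (((E N / N - eper) + C * ((N : ℝ) ^ (2 / 3 : ℝ) / N)) / g) 0) atTop (𝓝 0) := by
    have h := hbt.max (tendsto_const_nhds (x := (0 : ℝ)))
    rwa [max_eq_right hL] at h
  refine tendsto_of_tendsto_of_tendsto_of_le_of_le' tendsto_const_nhds hmax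
    (Eventually.of_forall fun N => div_nonneg (ha0 N) (Nat.cast_nonneg N)) ?_
  filter_upwards [eventually_gt_atTop 0] with N hN
  have hN : (0 : ℝ) < N := by exact_mod_cast hN
  refine le_trans ?_ (le_max_left _ _)
  rw [div_le_div_iff₀ hN hg]
  have hId : ((E N / N - eper) + C * ((N : ℝ) ^ (2 / 3 : ℝ) / N)) * N
      = E N - N * eper + C * (N : ℝ) ^ (2 / 3 : ℝ) := by
    field_simp
  rw [hId]
  linarith [hbound N]

/-- **`CoercivityForcesZeroDefects`** (item `stmt-AtomisticToContinuum-13605`, route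
`ReggeStarCoercivity`): star coercivity and the trial-state upper bound force zero density of
defective first shells along every sequence of Lennard-Jones ground states. A ground state `x N` is
injective with `𝓔(x N) = E(N)` (`IsGroundState`), so `StarCoercivity` gives
`N·e_per + g·#def − C·N^(2/3) ≤ E(N)`; `BlancLewin2015_8_holds` gives `E(N)/N → e_∞`, and
`CrysEnergyUpper` with `Tendsto.limsup_eq` gives `e_∞ ≤ e_per`; conclude by
`coercivityForcesZeroDefects_squeeze`. -/
theorem coercivityForcesZeroDefects_proof : CoercivityForcesZeroDefects := by
  unfold CoercivityForcesZeroDefects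
  intro hSC hUp x hx
  obtain ⟨g, hg, C, hC⟩ := hSC
  obtain ⟨e, -, hE, -⟩ := BlancLewin2015_8_holds 3 (by norm_num) (by norm_num)
  have he : e ≤ ⨅ Q : PeriodicConfiguration 3, Q.energyPerParticle lennardJones :=
    hE.limsup_eq.ge.trans hUp
  refine coercivityForcesZeroDefects_squeeze (C := C) hg (fun N => Nat.cast_nonneg _)
    (fun N => ?_) hE he
  obtain ⟨hinj, hEN⟩ := hx N
  have h := hC N (x N) hinj
  rwa [hEN] at h

end Summit.AtomisticToContinuum.Crystallization.Theorems

end
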